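import Mathlib
import Summits.KontsevichZagierPeriods.Zeta5Search.RecordCellAtlas
import HarnessLib

/-!
# ζ(5) search — the TIERED FAMILY ATLAS of first-digit cancellation cells (gen-2 g9 statement file; REPORT-gen2-g9 §10.4–10.5)
HONEST FRAMING: systematic search; no irrationality claim unless certified.

Setting: the consecutive family `bFam t n = n·(3t+8; t+6,…,t)` of `RecordCellAtlas.lean` (census g11; `t = 11` is Brown–Zudilin's
record ray, `t = 12, 14` are NEAR-MISSES rows 2, 3), least-parameter direction `j = 7`, `Cas₇ = casoratian (bFam t n) 7`, primes
`p = θ·n`.  Census g11 filed the three record cells as `FamilyCellA/B/D`; `FamilyCellA` is a tree THEOREM (`familyCellA_holds`, P1 g5).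

WHAT IS NEW HERE.  gen-2 g9's structural atlas (`g9/rayatlas.py`: per θ the deep residue-class TYPES, the regime, `casLB` = the
proved bound THEOREM LB, the exact orbit vectors `(Σĉ, Σv̂)` of the universal digit lemmas U-V/U-W/G1–G3 — all five now PROVED in the
tree, `UniversalDigitDischarge.lean` — and the resulting first-digit prediction: `zero` ⇒ `casLB + 2`, `origin`/`affine` ⇒ `casLB + 1`
by the moment lemma / collinearity criterion of REPORT §6, §8) was run (i) for every `t ≤ 66` separately (each run is an ALL-`n`
certificate: exhaustive enumeration of the faces of the `(u₀, θ)` line arrangement, `g9/famatlas.py`) and (ii) with `t` SYMBOLIC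
(`g9/famsym.py`: affine-in-`t` exact arithmetic, every `t`-dependent comparison records its threshold; maximal threshold `t = 64`), which
proves that for every `t ≥ 65` the atlas on `θ > t/4 + 1` consists of exactly the cells below, with endpoints affine in `t`.
RESULT (paper theorem modulo Theorem B — the classwise factorisation used throughout the ClusterValuation files — and the §6/§8 mechanisms):
the bonus cells come in TIERS `k = 1, 2, 3, …` (`θ ≈ t/k`) with the SAME pattern and bounds dropping by EXACTLY 8 per tier:
`A_k ((t+3)/k, (t+4)/k]` origin `−4−8(k−1)` · `Z_k ((t+4)/k, (t+5)/k]` zero `−3−8(k−1)` · `O_k ((t+5)/k, (t+6)/k]` origin `−4−8(k−1)` ·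
`O′_k ((t+6)/k, (3t+8)/(3k−1)]` origin `−6−8(k−1)` · `ZZ_k ((3t+8)/(3k−1), (t−4)/(k−1))` zero `−7−8(k−1)` · `P_k ((t−4)/(k−1), (t−3)/(k−1)]`
origin `−6−8(k−1)` · `Q_k ((t−3)/(k−1), (t−2)/(k−1)]` origin `−4−8(k−1)` · `B_k ((t+1)/k, (2t+3)/(2k)]` affine `−6−8(k−1)`
(`A_1 = FamilyCellA`, `B_1 = FamilyCellB`, `A_2 = FamilyCellD`).  Each statement below carries its CERTIFIED range `t ≥ t₀` (= the cell is
part of the per-`t` all-`n` atlas for every `t₀ ≤ t ≤ 66`, per parity class of `n` and endpoints included — `g9/famverify_t4-66.log` — and of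
the symbolic atlas for `t ≥ 65`) and its exact-instance count (`g9/famtier_exact.py`: `v_p(Cas₇)` exact; instances with `t ≤ 34`,
`n ≤ 3` over all cells: 206, 0 violations).  OBSERVED SLACK (open, second-digit theory): cells `A, B, Q, Z` are sharp (`v = bound` at most
instances) while `O_k` (+1), `P_k` (+1), `O′_k` (+2) and `ZZ_k` (+2/+3) show further vanishing digits at every instance.
All statements are `@[conjecture]`-tagged: the certification is a paper proof resting on Theorem B and on code (`rayatlas.column`) cross-checked
against ≈ 1 000 exact instances; the Lean proofs are P1's lane (`FamilyCellAProof.lean` is the template: `11n ↦ tn`, class data per cell from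
the "deep orbit types" column of `g9/rayatlas_*.md` / `g9/famsym_both.log`).
-/

namespace Summit.KontsevichZagierPeriods.Zeta5Search.FamilyTiers

open Summit.KontsevichZagierPeriods.Zeta5Search.CasoratianValuation (casoratian)
open Summit.KontsevichZagierPeriods.Zeta5Search.CellAtlas (bFam FamilyCellD FamilyCellB)

/-! ## Tier 1 complements (θ between t−4 and t−2) and the strengthened ranges of census's cells B and D -/

/-- **FamilyCellD from `t = 6`** (census stated `t ≥ 10`; the per-`t` atlases show the cell `((t+3)/2, (t+4)/2]`, origin mechanism, bound
`−12 = casLB + 1`, verbatim for every `6 ≤ t ≤ 66`, and the symbolic atlas for `t ≥ 65`; exact instances: 11/11, sharp). -/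
@[conjecture] def FamilyCellD6 : Prop :=
  ∀ t n p : ℕ, 6 ≤ t → 2 ≤ n → p.Prime → (t + 3) * n < 2 * p → 2 * p ≤ (t + 4) * n → casoratian (bFam t n) 7 ≠ 0 →
    (-12 : ℤ) ≤ padicValRat p (casoratian (bFam t n) 7)

/-- `FamilyCellD6` (t ≥ 6) implies census's `CellAtlas.FamilyCellD` (t ≥ 10): the same cell and bound on a wider range of `t`. -/
theorem familyCellD_of_D6 (h : FamilyCellD6) : FamilyCellD := by
  intro t n p ht hn hp h1 h2 hne
  exact h t n p (by omega) hn hp h1 (by omega) hne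

/-- **Cell Q₂ = (t−3, t−2)** (tier-1 image of `A`): origin mechanism, `casLB = −13`, bound `−12`; certified `t ≥ 12`; exact 20/20 (sharp at all but one). -/
@[conjecture] def FamilyCellQ2 : Prop :=
  ∀ t n p : ℕ, 12 ≤ t → 2 ≤ n → p.Prime → (t - 3) * n < p → p < (t - 2) * n → casoratian (bFam t n) 7 ≠ 0 →
    (-12 : ℤ) ≤ padicValRat p (casoratian (bFam t n) 7)

/-- **Cell P₂ = (t−4, t−3)**: origin mechanism, `casLB = −15`, bound `−14`; certified `t ≥ 14`; exact 18/18 (observed `v ≥ −13` at every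
instance: one further digit vanishes — OPEN). -/
@[conjecture] def FamilyCellP2 : Prop :=
  ∀ t n p : ℕ, 14 ≤ t → 2 ≤ n → p.Prime → (t - 4) * n < p → p < (t - 3) * n → casoratian (bFam t n) 7 ≠ 0 →
    (-14 : ℤ) ≤ padicValRat p (casoratian (bFam t n) 7)

/-- **Cell ZZ₂ = ((3t+8)/5, t−4)** — the LONG zero cell (length ≈ 0.4·t): regime H0, `m = −10`, `casLB = −17`, every deep orbit vector
vanishes (`zero` mechanism ⇒ two digits), bound `−15`; certified `t ≥ 15`; exact 56/56 (observed `v ∈ {−13, −12}`: OPEN slack +2/+3). -/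
@[conjecture] def FamilyCellZZ2 : Prop :=
  ∀ t n p : ℕ, 15 ≤ t → 2 ≤ n → p.Prime → (3 * t + 8) * n < 5 * p → p < (t - 4) * n → casoratian (bFam t n) 7 ≠ 0 →
    (-15 : ℤ) ≤ padicValRat p (casoratian (bFam t n) 7)

/-- **Cell O′₂ = ((t+6)/2, (3t+8)/5]**: origin mechanism, `m = −9`, `casLB = −15`, bound `−14`; certified `t ≥ 15`; exact 12/12
(observed `v = −12` at every instance: OPEN slack +2). -/
@[conjecture] def FamilyCellOp2 : Prop :=
  ∀ t n p : ℕ, 15 ≤ t → 2 ≤ n → p.Prime → (t + 6) * n < 2 * p → 5 * p ≤ (3 * t + 8) * n → casoratian (bFam t n) 7 ≠ 0 →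
    (-14 : ℤ) ≤ padicValRat p (casoratian (bFam t n) 7)

/-- **Cell O₂ = ((t+5)/2, (t+6)/2]**: origin mechanism, `casLB = −13`, bound `−12`; certified `t ≥ 12`; exact 10/10 (observed `v = −11`). -/
@[conjecture] def FamilyCellO2 : Prop :=
  ∀ t n p : ℕ, 12 ≤ t → 2 ≤ n → p.Prime → (t + 5) * n < 2 * p → 2 * p ≤ (t + 6) * n → casoratian (bFam t n) 7 ≠ 0 →
    (-12 : ℤ) ≤ padicValRat p (casoratian (bFam t n) 7)

/-- **Cell Z₂ = ((t+4)/2, (t+5)/2]**: regime H0, `m = −8`, `casLB = −13`, `zero` mechanism, bound `−11`; certified `t ≥ 14` (the open part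
from `t = 13`); exact 10/10 (8 sharp). -/
@[conjecture] def FamilyCellZ2 : Prop :=
  ∀ t n p : ℕ, 14 ≤ t → 2 ≤ n → p.Prime → (t + 4) * n < 2 * p → 2 * p ≤ (t + 5) * n → casoratian (bFam t n) 7 ≠ 0 →
    (-11 : ℤ) ≤ padicValRat p (casoratian (bFam t n) 7)

/-- **Cell B₂ = ((t+1)/2, (2t+3)/4]** (tier-2 image of `FamilyCellB`): `affine` mechanism (collinear orbit vectors, moment range), `m = −9`,
`casLB = −15`, bound `−14`; certified `t ≥ 13`; exact 2/2 sharp (row 3 = `t = 14` carries it at `(15/2, 31/4]`). -/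
@[conjecture] def FamilyCellB2 : Prop :=
  ∀ t n p : ℕ, 13 ≤ t → 2 ≤ n → p.Prime → (t + 1) * n < 2 * p → 4 * p ≤ (2 * t + 3) * n → casoratian (bFam t n) 7 ≠ 0 →
    (-14 : ℤ) ≤ padicValRat p (casoratian (bFam t n) 7)

/-! ## Tier 3 (θ ≈ t/3; bounds = tier 2 bounds − 8) -/

/-- **Cell A₃ = ((t+3)/3, (t+4)/3]**: origin, `casLB = −21`, bound `−20`; certified `t ≥ 11`; exact 8/8 (mostly sharp). -/
@[conjecture] def FamilyCellA3 : Prop :=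
  ∀ t n p : ℕ, 11 ≤ t → 2 ≤ n → p.Prime → (t + 3) * n < 3 * p → 3 * p ≤ (t + 4) * n → casoratian (bFam t n) 7 ≠ 0 →
    (-20 : ℤ) ≤ padicValRat p (casoratian (bFam t n) 7)

/-- **Cell Z₃ = ((t+4)/3, (t+5)/3]**: zero, `casLB = −21`, bound `−19`; certified `t ≥ 23`; exact 3/3. -/
@[conjecture] def FamilyCellZ3 : Prop :=
  ∀ t n p : ℕ, 23 ≤ t → 2 ≤ n → p.Prime → (t + 4) * n < 3 * p → 3 * p ≤ (t + 5) * n → casoratian (bFam t n) 7 ≠ 0 →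
    (-19 : ℤ) ≤ padicValRat p (casoratian (bFam t n) 7)

/-- **Cell O₃ = ((t+5)/3, (t+6)/3]**: origin, `casLB = −21`, bound `−20`; certified `t ≥ 21`; exact 3/3 (observed `v = −19` where recorded). -/
@[conjecture] def FamilyCellO3 : Prop :=
  ∀ t n p : ℕ, 21 ≤ t → 2 ≤ n → p.Prime → (t + 5) * n < 3 * p → 3 * p ≤ (t + 6) * n → casoratian (bFam t n) 7 ≠ 0 →
    (-20 : ℤ) ≤ padicValRat p (casoratian (bFam t n) 7)

/-- **Cell O′₃ = ((t+6)/3, (3t+8)/8]**: origin, `m = −13`, `casLB = −23`, bound `−22`; certified `t ≥ 25`; exact 1/1 (`v = −20`). -/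
@[conjecture] def FamilyCellOp3 : Prop :=
  ∀ t n p : ℕ, 25 ≤ t → 2 ≤ n → p.Prime → (t + 6) * n < 3 * p → 8 * p ≤ (3 * t + 8) * n → casoratian (bFam t n) 7 ≠ 0 →
    (-22 : ℤ) ≤ padicValRat p (casoratian (bFam t n) 7)

/-- **Cell ZZ₃ = ((3t+8)/8, (t−4)/2)**: zero, `m = −14`, `casLB = −25`, bound `−23`; certified `t ≥ 25`; exact 1/1 (`v = −21`). -/
@[conjecture] def FamilyCellZZ3 : Prop :=
  ∀ t n p : ℕ, 25 ≤ t → 2 ≤ n → p.Prime → (3 * t + 8) * n < 8 * p → 2 * p < (t - 4) * n → casoratian (bFam t n) 7 ≠ 0 →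
    (-23 : ℤ) ≤ padicValRat p (casoratian (bFam t n) 7)

/-- **Cell P₃ = ((t−4)/2, (t−3)/2]**: origin, `casLB = −23`, bound `−22`; certified `t ≥ 24`; exact 4/4 (observed `v = −21`). -/
@[conjecture] def FamilyCellP3 : Prop :=
  ∀ t n p : ℕ, 24 ≤ t → 2 ≤ n → p.Prime → (t - 4) * n < 2 * p → 2 * p ≤ (t - 3) * n → casoratian (bFam t n) 7 ≠ 0 →
    (-22 : ℤ) ≤ padicValRat p (casoratian (bFam t n) 7)

/-- **Cell Q₃ = ((t−3)/2, (t−2)/2]**: origin, `casLB = −21`, bound `−20`; certified `t ≥ 21`; exact 6/6 (mostly sharp). -/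
@[conjecture] def FamilyCellQ3 : Prop :=
  ∀ t n p : ℕ, 21 ≤ t → 2 ≤ n → p.Prime → (t - 3) * n < 2 * p → 2 * p ≤ (t - 2) * n → casoratian (bFam t n) 7 ≠ 0 →
    (-20 : ℤ) ≤ padicValRat p (casoratian (bFam t n) 7)

/-- **Cell B₃ = ((t+1)/3, (2t+3)/6]**: affine, `m = −13`, `casLB = −23`, bound `−22`; certified `t ≥ 20`; exact 3/3 sharp. -/
@[conjecture] def FamilyCellB3 : Prop :=
  ∀ t n p : ℕ, 20 ≤ t → 2 ≤ n → p.Prime → (t + 1) * n < 3 * p → 6 * p ≤ (2 * t + 3) * n → casoratian (bFam t n) 7 ≠ 0 →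
    (-22 : ℤ) ≤ padicValRat p (casoratian (bFam t n) 7)

/-! ## Tier 4 above θ = t/4 + 1 (certified ranges; bounds = tier 3 bounds − 8): `Z₄ ((t+4)/4,(t+5)/4]` zero −27 (t ≥ 32), `O₄` origin −28
(t ≥ 30), `O′₄ ((t+6)/4,(3t+8)/11]` origin −30 (t ≥ 35), `ZZ₄ ((3t+8)/11,(t−4)/3)` zero −31 (t ≥ 35), `P₄` origin −30 (t ≥ 34), `Q₄` origin −28
(t ≥ 30) — not typed separately (same shape; file them when tier 3 is in hand).  The TIER LAW for all `k` (pattern + `−8` per tier, `t ≥ t₀(k)`)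
is a CONJECTURE beyond `k = 4`. -/

end Summit.KontsevichZagierPeriods.Zeta5Search.FamilyTiers
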